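import Summits.KontsevichZagierPeriods.KontsevichZagierPeriods.Theorems.IsometryMove.Negative.Kit

/-!
# `IsometryMove` (stmt-KontsevichZagierPeriods-3471) — negative side V: more variants, non-vacuity

(i) The transcription slip `Complex.normSq (ad − bc)` for the height numerator `‖ad − bc‖` is FALSE
(`not_isometryMoveNormSqHeight`; witness `a = 2`: value × `1/4`) — not an instance of the rational
height scalings of `Negative/Tightness.lean`. (ii) The natural STRENGTHENING of the crux that is
true and is what a one-move proof delivers: `IsometryMoveOneMove` (conclusion
`of r − of r' ∈ KZ.changeOfVariablesRel`) implies the crux (`gen_of_oneMove` + `isometryMove_iff_gen`); it is not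
refutable by evaluation. (iii) NON-VACUITY `cruxHypotheses_satisfiable`: the homothety `a = 2`
carries the unit box onto a box representation of the same positive value, meeting every
hypothesis of the crux. [Kontsevich–Zagier 2001, §1.2]
-/

noncomputable section

open MeasureTheory Set MvPolynomial intervalIntegral
open Literature.NumberTheory.Transcendental Literature.ModelTheory.ExponentialFields

namespace Summit.KontsevichZagierPeriods.HyperbolicBloch.IsometryMoveNegative

open Summit.KontsevichZagierPeriods.KontsevichZagierPeriods (Theses.HyperbolicBloch.IsometryMove)

/-! ## §8 (gen 3) More tightness: the `normSq` transcription slip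

A plausible mis-transcription of the height numerator is `Complex.normSq (ad − bc) = |ad − bc|²` in
place of `‖ad − bc‖`. It is FALSE (witness `a = 2, d = 1, b = c = 0, ε = 1`: height `4`, typed map
`diag(2, 2, 4)`, value of the unit box multiplied by `2·2·4·4⁻³ = 1/4`). Note this is NOT an
instance of `not_isometryMoveHeightScale` (the scale `|ad − bc|` is data-dependent). -/

/-- The crux with height numerator `|ad − bc|²` (`Complex.normSq`) in place of `‖ad − bc‖`. -/
def IsometryMoveNormSqHeight : Prop :=
  IsometryMoveGen CruxAdm (fun a b c d => Complex.normSq (a * d - b * c)) 3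

/-- **The `normSq` slip is false**: witness `a = 2`, `b = c = 0`, `d = 1`, `ε = 1`. [folklore] -/
theorem not_isometryMoveNormSqHeight : ¬ IsometryMoveNormSqHeight := by
  have hI := integral_powInv_pos 3 (zero_lt_one' ℝ) one_lt_two
  refine gen_false_of_diag 2 1 (by simpa using isAlgebraic_nat (R := ℚ) (A := ℂ) 2)
    (cruxAdm_diag two_ne_zero (Or.inl rfl)) ![2, 2, 4]
    (by funext i; fin_cases i <;> simp; norm_num) (unitBoxRep 3)
    (boxRep 3 ![0, 0, 4] ![2, 2, 8] (Or.inl (by simp)))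
    (unitBoxRep_domain_subset 3) (fun _ _ => rfl) ?_ (fun _ _ => rfl) ?_
  · rw [boxRep_domain, unitBoxRep, boxRep_domain, box, box, diagMap_image_pi]
    refine pi_eq_pi ?_ ?_ ?_
    · simp [image_mul_left_Ioo (zero_lt_two' ℝ)]
    · simp [image_mul_left_Ioo (zero_lt_two' ℝ)]
    · simp only [image_mul_left_Ioo (zero_lt_four' ℝ), Matrix.cons_val_two, Matrix.tail_cons,
        Matrix.head_cons, Rat.cast_ofNat]
      norm_num
  · rw [value_unitBoxRep, value_boxRep 3 _ _ _ (fun i => by fin_cases i <;> norm_num)]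
    simp only [Matrix.cons_val_zero, Matrix.cons_val_one, Matrix.head_cons, Matrix.cons_val_two,
      Matrix.tail_cons, Rat.cast_zero, Rat.cast_ofNat, sub_zero]
    have hB : ∫ t in (4 : ℝ)..8, 1 / t ^ 3 = 4 * (1 / (4 : ℝ) ^ 3 * ∫ t in (1 : ℝ)..2, 1 / t ^ 3) := by
      have := integral_powInv_scale 3 (4 : ℝ) 1 2
      rwa [show (4 : ℝ) * 1 = 4 by norm_num, show (4 : ℝ) * 2 = 8 by norm_num] at this
    rw [hB]
    intro h
    rw [show (4 : ℝ) ^ 3 = 64 by norm_num] at h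
    linarith

/-! ## §9 (gen 3) The natural STRENGTHENING that is true: one single move

The informal text claims ONE `changeOfVariablesRel` move with `Φ = g`. `IsometryMoveOneMove` is
that literal strengthening (`of r − of r' ∈ changeOfVariablesRel` instead of `Equivalent r r'`);
it implies the crux (`gen_of_oneMove`, family form) and is what the active line
`quaternion-difference-quotient` proves. It is NOT refutable by evaluation (values agree) and we
know no finer invariant of a single move; recorded so that planners may cite the exact target. -/

/-- The crux with conclusion strengthened to a SINGLE change-of-variables move
`of r - of r' ∈ KZ.changeOfVariablesRel`. -/
def IsometryMoveOneMove : Prop :=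
  ∀ (a b c d : ℂ) (ε : ℝ), IsAlgebraic ℚ a → IsAlgebraic ℚ b → IsAlgebraic ℚ c → IsAlgebraic ℚ d →
    CruxAdm a b c d ε →
    ∀ (g : (Fin 3 → ℝ) → (Fin 3 → ℝ)),
      (∀ p, g p = ![(num a b c d ε p).re / den c d ε p, (num a b c d ε p).im / den c d ε p,
        cruxHeight a b c d * p 2 / den c d ε p]) →
      ∀ (r r' : KZ.IntegralRep 3), r.domain ⊆ {p | 0 < p 2} →
        Set.EqOn r.integrand (powDensity 3) r.domain → r'.domain = g '' r.domain →
        Set.EqOn r'.integrand (powDensity 3) r'.domain → KZ.of r - KZ.of r' ∈ KZ.changeOfVariablesRel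

/-- The one-move form implies the crux in its family form `IsometryMoveGen CruxAdm cruxHeight 3`
(`= IsometryMove` by `isometryMove_iff_gen`): a single move is a relation. [folklore] -/
theorem gen_of_oneMove (h : IsometryMoveOneMove) : IsometryMoveGen CruxAdm cruxHeight 3 :=
  fun a b c d ε ha hb hc hd hadm g hg r r' h1 h2 h3 h4 =>
    KZ.changeOfVariablesRel_subset_relations (h a b c d ε ha hb hc hd hadm g hg r r' h1 h2 h3 h4)


/-! ## §10 (gen 3) Non-vacuity: the hypotheses of the crux are jointly satisfiable, non-trivially

The crux is not "true for lack of instances": the homothety `a = 2, d = 1, b = c = 0, ε = 1`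
(`p ↦ 2p`, a genuine hyperbolic isometry) carries the unit box `(0,1)² × (1,2)` (value
`∫_1^2 t⁻³ = 3/8 > 0`) onto the box `(0,2)² × (2,4)`, which IS the domain of a representation with
density `t⁻³` and the SAME value (`4 · ∫_2^4 t⁻³ = 3/8`) — consistent with the crux, as it must be. -/

/-- NON-VACUITY of the crux: admissible non-identity data, a representation `r` of positive value and a
representation `r'` on the image with the same value satisfy every hypothesis of `IsometryMove`. [folklore] -/
theorem cruxHypotheses_satisfiable :
    ∃ (a b c d : ℂ) (ε : ℝ), IsAlgebraic ℚ a ∧ IsAlgebraic ℚ b ∧ IsAlgebraic ℚ c ∧ IsAlgebraic ℚ d ∧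
      CruxAdm a b c d ε ∧ a ≠ 1 ∧ ∃ (r r' : KZ.IntegralRep 3), r.domain ⊆ {p | 0 < p 2} ∧
        Set.EqOn r.integrand (powDensity 3) r.domain ∧
        r'.domain = (fun p => ![(num a b c d ε p).re / den c d ε p, (num a b c d ε p).im / den c d ε p,
          cruxHeight a b c d * p 2 / den c d ε p]) '' r.domain ∧
        Set.EqOn r'.integrand (powDensity 3) r'.domain ∧ 0 < r.value ∧ r'.value = r.value := by
  refine ⟨((2 : ℝ) : ℂ), 0, 0, 1, 1, by simpa using isAlgebraic_nat (R := ℚ) (A := ℂ) 2,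
    isAlgebraic_zero, isAlgebraic_zero, isAlgebraic_one, cruxAdm_diag two_ne_zero (Or.inl rfl),
    by norm_num, unitBoxRep 3, boxRep 3 ![0, 0, 2] ![2, 2, 4] (Or.inl (by simp)),
    unitBoxRep_domain_subset 3, fun _ _ => rfl, ?_, fun _ _ => rfl, value_unitBoxRep_pos 3, ?_⟩
  · have hfun : (fun p => ![(num ((2 : ℝ) : ℂ) 0 0 1 1 p).re / den 0 1 1 p,
        (num ((2 : ℝ) : ℂ) 0 0 1 1 p).im / den 0 1 1 p, cruxHeight ((2 : ℝ) : ℂ) 0 0 1 * p 2 / den 0 1 1 p])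
        = diagMap ![2, 2, 2] := by
      funext p
      rw [formula_diag 2 1 (cruxHeight ((2 : ℝ) : ℂ) 0 0 1) p]
      have hD : (![(2 : ℝ), 2 * 1, cruxHeight ((2 : ℝ) : ℂ) 0 0 1] : Fin 3 → ℝ) = ![2, 2, 2] := by
        funext i; fin_cases i <;> simp [cruxHeight]
      rw [hD]; rfl
    rw [hfun, boxRep_domain, unitBoxRep, boxRep_domain, box, box, diagMap_image_pi]
    refine pi_eq_pi ?_ ?_ ?_
    · simp [image_mul_left_Ioo (zero_lt_two' ℝ)]
    · simp [image_mul_left_Ioo (zero_lt_two' ℝ)]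
    · simp only [image_mul_left_Ioo (zero_lt_two' ℝ), Matrix.cons_val_two, Matrix.tail_cons,
        Matrix.head_cons, Rat.cast_ofNat]
      norm_num
  · rw [value_unitBoxRep, value_boxRep 3 _ _ _ (fun i => by fin_cases i <;> norm_num)]
    simp only [Matrix.cons_val_zero, Matrix.cons_val_one, Matrix.head_cons, Matrix.cons_val_two,
      Matrix.tail_cons, Rat.cast_zero, Rat.cast_ofNat, sub_zero]
    have hB : ∫ t in (2 : ℝ)..4, 1 / t ^ 3 = 2 * (1 / (2 : ℝ) ^ 3 * ∫ t in (1 : ℝ)..2, 1 / t ^ 3) := by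
      have := integral_powInv_scale 3 (2 : ℝ) 1 2
      rwa [show (2 : ℝ) * 1 = 2 by norm_num, show (2 : ℝ) * 2 = 4 by norm_num] at this
    rw [hB]
    ring

end Summit.KontsevichZagierPeriods.HyperbolicBloch.IsometryMoveNegative

end
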